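import Summits.NavierStokesRegularity.NavierStokesRegularity.Theorems.PerpetualPumpThesisBesovDuhamelBoundAnnular
import Summits.NavierStokesRegularity.NavierStokesRegularity.Theorems.PerpetualPumpThesisBesovDuhamelBoundBridge
import Literature.Analysis.FluidPDE.TaoAveragedSlotFourier

/-!
# Stub `besovDuhamelBound` for `PerpetualPump.Thesis`, part VIII: Tao's slots
# `A = m(D) Rot_R Dil_λ` are bounded from `Ḃ⁰_{∞,1}` to `L^∞`

Support file (part 8 of the stub `besovDuhamelBound` of line `SketchIdeator2`, crux
stmt-NavierStokesRegularity-1832). The random operators of Tao's averaging (J. Amer. Math. Soc. 29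
(2016), (1.12): `Aᵢ(θ) = m_{i,θ}(D) Rot_{R_{i,θ}} Dil_{λ_{i,θ}}`) are not bounded on `L^∞`
(order-`0` multipliers), but they are bounded on the Besov space `Ḃ⁰_{∞,1} ⊂ L^∞`:

* `FA.exists_eHomBesovNorm_coe_fourierMultiplier_le`: `‖m(D) g‖_{Ḃ⁰_{∞,1}} ≤ C (∑_{i≤n} ‖m‖_i)
  ‖g‖_{Ḃ⁰_{∞,1}}` for `m ∈ 𝓜₀` (blockwise `Δ̇_k m(D) = (mψ_k)(D) Δ̇_k`, part II);
* `FA.exists_eHomBesovNorm_coe_rot_le`: `‖Rot_R h‖_{Ḃ⁰_{∞,1}} ≤ C ‖h‖_{Ḃ⁰_{∞,1}}`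
  (`Δ̇_k Rot_R = Rot_R φ_k(R D)` and part VII with `ρ = 1`);
* `FA.exists_eHomBesovNorm_coe_dil_le`: `‖Dil_ρ h‖_{Ḃ⁰_{∞,1}} ≤ C_N ‖h‖_{Ḃ⁰_{∞,1}}` for
  `2^{-N} ≤ ρ ≤ 2^N` (`Δ̇_k (v(ρ ·)) = (φ_k(ρ D) v)(ρ ·)`, part VII);
* `FA.exists_eLpNorm_slot_le`: for every averaging datum `𝒜`,
  **`‖Aᵢ(θ) f‖_{L^∞} ≤ C (∑_{j ≤ n} ‖m_{i,θ}‖_j) ‖f‖_{Ḃ⁰_{∞,1}}`** for all `i, θ, f ∈ L²(ℝ³; ℂ³)`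
  (with `Ḃ⁰_{∞,1} ∩ L² ⊂ L^∞`, part Embed of stub F), the constant depending only on `𝒜` through
  the dilation range `[C⁻¹, C]`.

## References

* T. Tao, J. Amer. Math. Soc. 29 (2016), 601–674, (1.10)–(1.12).
* H. Bahouri, J.-Y. Chemin, R. Danchin, *Fourier Analysis and Nonlinear PDE* (2011), Lemma 2.2,
  Prop. 2.18.
-/

noncomputable section

open MeasureTheory TemperedDistribution Filter Topology FourierTransform
open scoped SchwartzMap ENNReal NNReal

set_option linter.dupNamespace false

namespace Summit.NavierStokesRegularity.NavierStokesRegularity.Theorems.PerpetualPumpThesis.FA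

open Literature.Analysis.FunctionSpaces Literature.Analysis.FluidPDE
  Literature.Analysis.FluidPDE.Tao2016

/-! ### `m(D)` on `Ḃ⁰_{∞,1}` -/

/-- The block truncation of a real order-`0` symbol is bounded (continuous, compact support). -/
theorem exists_bound_truncSymbol {m : EuclideanSpace ℝ (Fin 3) → ℂ} (hm : IsRealSymbol m) (k : ℤ) :
    ∃ B : ℝ, ∀ ξ, ‖truncSymbol m k ξ‖ ≤ B := by
  have hc : Continuous (truncSymbol m k) := (contDiff_truncSymbol (contDiffOn_of_isRealSymbol hm) k).continuous
  obtain ⟨B, hB⟩ := (hasCompactSupport_truncSymbol m k).exists_bound_of_continuous hc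
  exact ⟨B, hB⟩

/-- **`Δ̇_k m(D) = (mψ_k)(D) Δ̇_k` on `L²(ℝ³; ℂ³)`**: the block of `m(D) g` is the truncated multiplier
applied to the block of `g` (`φ_k m = (m ψ_k) φ_k`). -/
theorem lpBlock_coe_fourierMultiplier {m : EuclideanSpace ℝ (Fin 3) → ℂ} (hm : IsRealSymbol m)
    (k : ℤ) (g : L2C) :
    lpBlock k ((fourierMultiplier (hm.memLp_top.toLp m) g : L2C) :
        𝓢'(EuclideanSpace ℝ (Fin 3), EuclideanSpace ℂ (Fin 3))) =
      fourierMultiplierCLM (EuclideanSpace ℂ (Fin 3)) (truncSymbol m k)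
        (lpBlock k ((g : L2C) : 𝓢'(EuclideanSpace ℝ (Fin 3), EuclideanSpace ℂ (Fin 3)))) := by
  obtain ⟨Bt, hBt⟩ := exists_bound_truncSymbol hm k
  have hTc : Continuous (truncSymbol m k) :=
    (contDiff_truncSymbol (contDiffOn_of_isRealSymbol hm) k).continuous
  have hTtop : MemLp (truncSymbol m k) ∞ (volume : Measure (EuclideanSpace ℝ (Fin 3))) :=
    memLp_top_of_bound hTc.aestronglyMeasurable Bt (ae_of_all _ hBt)
  have hTt : (truncSymbol m k).HasTemperateGrowth := hasTemperateGrowth_truncSymbol (contDiffOn_of_isRealSymbol hm) k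
  -- the product symbol `φ_k m = (m ψ_k) φ_k`
  set P : EuclideanSpace ℝ (Fin 3) → ℂ := fun ξ => truncSymbol m k ξ * dyadicSymbol k ξ with hP
  have hPtop : MemLp P ∞ (volume : Measure (EuclideanSpace ℝ (Fin 3))) := by
    refine memLp_top_of_bound (hTc.mul (contDiff_dyadicSymbol k).continuous).aestronglyMeasurable
      (Bt * 2) (ae_of_all _ fun ξ => ?_)
    rw [hP, norm_mul]
    exact mul_le_mul (hBt ξ) (norm_dyadicSymbol_le_two k ξ) (norm_nonneg _)
      ((norm_nonneg _).trans (hBt ξ))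
  have hPm : ∀ ξ, P ξ = dyadicSymbol k ξ * m ξ := by
    intro ξ
    have h := congr_fun (dyadicSymbol_mul_bernsteinSymbol_rescaled (E := EuclideanSpace ℝ (Fin 3)) k) ξ
    simp only [Pi.mul_apply] at h
    simp only [hP]
    rw [truncSymbol_apply]
    calc m ξ * bernsteinSymbol (((2 : ℝ) ^ (-k)) • ξ) * dyadicSymbol k ξ
        = m ξ * (dyadicSymbol k ξ * bernsteinSymbol (((2 : ℝ) ^ (-k)) • ξ)) := by ring
      _ = dyadicSymbol k ξ * m ξ := by rw [h, mul_comm]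
  -- both compositions are the multiplier with symbol `P`
  have h1 : fourierMultiplier ((memLp_top_dyadicSymbol (E := EuclideanSpace ℝ (Fin 3)) k).toLp _)
      (fourierMultiplier (hm.memLp_top.toLp m) g) = fourierMultiplier (hPtop.toLp P) g := by
    refine fourierMultiplier_fourierMultiplier _ _ _ ?_ g
    filter_upwards [hPtop.coeFn_toLp, (memLp_top_dyadicSymbol (E := EuclideanSpace ℝ (Fin 3)) k).coeFn_toLp,
      hm.memLp_top.coeFn_toLp] with ξ e1 e2 e3
    rw [e1, e2, e3, hPm]
  have h2 : fourierMultiplier (hTtop.toLp _)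
      (fourierMultiplier ((memLp_top_dyadicSymbol (E := EuclideanSpace ℝ (Fin 3)) k).toLp _) g) =
        fourierMultiplier (hPtop.toLp P) g := by
    refine fourierMultiplier_fourierMultiplier _ _ _ ?_ g
    filter_upwards [hPtop.coeFn_toLp, (memLp_top_dyadicSymbol (E := EuclideanSpace ℝ (Fin 3)) k).coeFn_toLp,
      hTtop.coeFn_toLp] with ξ e1 e2 e3
    rw [e1, e2, e3, hP]
  rw [lpBlock_apply, lpBlock_apply,
    ← coe_fourierMultiplier (hasTemperateGrowth_dyadicSymbol k) (memLp_top_dyadicSymbol k),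
    ← coe_fourierMultiplier (hasTemperateGrowth_dyadicSymbol k) (memLp_top_dyadicSymbol k),
    ← coe_fourierMultiplier hTt hTtop, h1, h2]

/-- **Order-`0` multipliers are bounded on `Ḃ⁰_{∞,1}(ℝ³; ℂ³) ∩ L²`, linearly in `∑ ‖m‖_i`**:
there are `n`, `C` with `‖m(D) g‖_{Ḃ⁰_{∞,1}} ≤ C (∑_{i≤n} ‖m‖_i) ‖g‖_{Ḃ⁰_{∞,1}}` for all `m ∈ 𝓜₀`,
`g ∈ L²`. -/
theorem exists_eHomBesovNorm_coe_fourierMultiplier_le :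
    ∃ (n : ℕ) (C : ℝ≥0), ∀ (m : EuclideanSpace ℝ (Fin 3) → ℂ) (hm : IsRealSymbol m) (g : L2C),
      eHomBesovNorm 0 ∞ 1 ((fourierMultiplier (hm.memLp_top.toLp m) g : L2C) :
          𝓢'(EuclideanSpace ℝ (Fin 3), EuclideanSpace ℂ (Fin 3))) ≤
        C * ENNReal.ofReal (∑ i ∈ Finset.range (n + 1), (symbolSeminorm i m).toReal) *
          eHomBesovNorm 0 ∞ 1 ((g : L2C) : 𝓢'(EuclideanSpace ℝ (Fin 3), EuclideanSpace ℂ (Fin 3))) := by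
  obtain ⟨n, C, hC⟩ := exists_eLpNormDistrib_truncSymbol_lpBlock_le_sum (F := EuclideanSpace ℂ (Fin 3))
  refine ⟨n, C, fun m hm g => ?_⟩
  rw [eHomBesovNorm_zero_one_eq_tsum, eHomBesovNorm_zero_one_eq_tsum, ← ENNReal.tsum_mul_left]
  refine ENNReal.tsum_le_tsum fun k => ?_
  rw [lpBlock_coe_fourierMultiplier hm k g]
  exact hC m hm k _

/-! ### `Rot_R` on `Ḃ⁰_{∞,1}` -/

/-- `L^∞` norms are invariant under `Rot_R`. -/
theorem eLpNorm_rot_top (R : EuclideanSpace ℝ (Fin 3) ≃ₗᵢ[ℝ] EuclideanSpace ℝ (Fin 3)) (X : L2C) :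
    eLpNorm ((rot R X : L2C) : EuclideanSpace ℝ (Fin 3) → EuclideanSpace ℂ (Fin 3)) ∞ volume =
      eLpNorm ((X : L2C) : EuclideanSpace ℝ (Fin 3) → EuclideanSpace ℂ (Fin 3)) ∞ volume := by
  rw [eLpNorm_congr_ae (coeFn_rot R X),
    eLpNorm_congr_norm_ae (ae_of_all _ fun x => norm_complexifyCLM R _)]
  exact eLpNorm_comp_measurePreserving (Lp.memLp X).1 R.symm.measurePreserving

/-- `𝓕⁻¹` commutes with `Rot_R` on `L²`. -/
theorem fourierInv_rot (R : EuclideanSpace ℝ (Fin 3) ≃ₗᵢ[ℝ] EuclideanSpace ℝ (Fin 3)) (v : L2C) :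
    (𝓕⁻ (rot R v) : L2C) = rot R (𝓕⁻ v : L2C) := by
  have h := fourier_rot R (𝓕⁻ v : L2C)
  rw [fourier_fourierInv_eq] at h
  rw [← h, fourierInv_fourier_eq]

/-- **`Δ̇_k Rot_R = Rot_R φ_k(R D)` on `L²(ℝ³; ℂ³)`**: the block multiplier of a rotated field is the
rotation of the field multiplied by the rotated bump `φ_k ∘ R = φ₀(2^{-k} R ·)`. -/
theorem fourierMultiplier_dyadic_rot (R : EuclideanSpace ℝ (Fin 3) ≃ₗᵢ[ℝ] EuclideanSpace ℝ (Fin 3))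
    (k : ℤ) (h : L2C)
    (hgtop : MemLp (fun ξ : EuclideanSpace ℝ (Fin 3) => dyadicSymbol 0 ((((2 : ℝ) ^ (-k)) * 1) • R ξ)) ∞
      (volume : Measure (EuclideanSpace ℝ (Fin 3)))) :
    fourierMultiplier ((memLp_top_dyadicSymbol (E := EuclideanSpace ℝ (Fin 3)) k).toLp _) (rot R h) =
      rot R (fourierMultiplier (hgtop.toLp _) h) := by
  unfold fourierMultiplier
  rw [fourier_rot, ← fourierInv_rot]
  congr 1
  apply Lp.ext
  have hq := R.symm.measurePreserving.quasiMeasurePreserving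
  filter_upwards [Lp.coeFn_lpSMul (r := 2) ((memLp_top_dyadicSymbol (E := EuclideanSpace ℝ (Fin 3)) k).toLp _)
      (rot R (𝓕 h : L2C)),
    (memLp_top_dyadicSymbol (E := EuclideanSpace ℝ (Fin 3)) k).coeFn_toLp, coeFn_rot R (𝓕 h : L2C),
    coeFn_rot R ((hgtop.toLp _ • (𝓕 h : L2C) : L2C)),
    hq.ae_eq (Lp.coeFn_lpSMul (r := 2) (hgtop.toLp _) (𝓕 h : L2C)),
    hq.ae_eq hgtop.coeFn_toLp] with ξ e1 e2 e3 e4 e5 e6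
  simp only [Function.comp_apply] at e5 e6
  rw [e1, Pi.smul_apply', e2, e3, e4, e5, Pi.smul_apply', e6, map_smul, mul_one,
    LinearIsometryEquiv.apply_symm_apply, dyadicSymbol_eq_dyadicSymbol_zero_smul k ξ]

/-- **Rotations are bounded on `Ḃ⁰_{∞,1}(ℝ³; ℂ³) ∩ L²`**: `‖Rot_R h‖_{Ḃ⁰_{∞,1}} ≤ C ‖h‖_{Ḃ⁰_{∞,1}}`
for all rotations `R` and `h ∈ L²`, `C` universal. -/
theorem exists_eHomBesovNorm_coe_rot_le :
    ∃ C : ℝ≥0, ∀ (R : EuclideanSpace ℝ (Fin 3) ≃ₗᵢ[ℝ] EuclideanSpace ℝ (Fin 3)) (h : L2C),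
      eHomBesovNorm 0 ∞ 1 ((rot R h : L2C) : 𝓢'(EuclideanSpace ℝ (Fin 3), EuclideanSpace ℂ (Fin 3))) ≤
        C * eHomBesovNorm 0 ∞ 1 ((h : L2C) : 𝓢'(EuclideanSpace ℝ (Fin 3), EuclideanSpace ℂ (Fin 3))) := by
  obtain ⟨C, hC⟩ := exists_tsum_eLpNormDistrib_annularMultiplier_le (E := EuclideanSpace ℝ (Fin 3))
    (F := EuclideanSpace ℂ (Fin 3)) 0
  refine ⟨C, fun R h => ?_⟩
  have h1 := hC 1 (by norm_num) (by norm_num) R ((h : L2C) : 𝓢'(EuclideanSpace ℝ (Fin 3), EuclideanSpace ℂ (Fin 3)))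
  refine le_trans (le_of_eq ?_) h1
  rw [eHomBesovNorm_zero_one_eq_tsum]
  refine tsum_congr fun k => ?_
  have hgt : (fun ξ : EuclideanSpace ℝ (Fin 3) => dyadicSymbol 0 ((((2 : ℝ) ^ (-k)) * 1) • R ξ)).HasTemperateGrowth :=
    hasTemperateGrowth_annular _ R
  have hgtop : MemLp (fun ξ : EuclideanSpace ℝ (Fin 3) => dyadicSymbol 0 ((((2 : ℝ) ^ (-k)) * 1) • R ξ)) ∞
      (volume : Measure (EuclideanSpace ℝ (Fin 3))) :=
    memLp_top_of_bound hgt.1.continuous.aestronglyMeasurable 2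
      (ae_of_all _ fun ξ => norm_dyadicSymbol_le_two 0 _)
  rw [lpBlock_apply, ← coe_fourierMultiplier (hasTemperateGrowth_dyadicSymbol k) (memLp_top_dyadicSymbol k),
    fourierMultiplier_dyadic_rot R k h hgtop, F.eLpNormDistrib_coe_two_eq_eLpNorm, eLpNorm_rot_top,
    ← F.eLpNormDistrib_coe_two_eq_eLpNorm, coe_fourierMultiplier hgt hgtop]

/-! ### `Dil_ρ` on `Ḃ⁰_{∞,1}` -/

/-- **Tao's dilation on distributions**: `Dil_ρ h = ρ^{3/2} · h(ρ ·)` as tempered distributions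
(`ρ ≠ 0`). -/
theorem coe_dil {ρ : ℝ} (hρ : ρ ≠ 0) (h : L2C) :
    ((dil ρ h : L2C) : 𝓢'(EuclideanSpace ℝ (Fin 3), EuclideanSpace ℂ (Fin 3))) =
      (((ρ ^ ((3 : ℝ) / 2) : ℝ)) : ℂ) •
        distribDilate (Units.mk0 ρ hρ) ((h : L2C) : 𝓢'(EuclideanSpace ℝ (Fin 3), EuclideanSpace ℂ (Fin 3))) := by
  unfold dil
  rw [dif_neg hρ, ← Lp.toTemperedDistributionCLM_apply, map_smul, Lp.toTemperedDistributionCLM_apply,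
    distribDilate_coe_holds (Units.mk0 ρ hρ) h ((memLp_comp_smul hρ h).toLp _)
      (MemLp.coeFn_toLp (memLp_comp_smul hρ h))]

/-- `ρ^{3/2} ≤ 4^N` for `ρ ≤ 2^N`. -/
theorem rpow_three_halves_le {N : ℕ} {ρ : ℝ} (hρ0 : 0 ≤ ρ) (hρ₂ : ρ ≤ (2 : ℝ) ^ (N : ℤ)) :
    ρ ^ ((3 : ℝ) / 2) ≤ (4 : ℝ) ^ N := by
  have h4 : (4 : ℝ) ^ N = ((2 : ℝ) ^ (N : ℤ)) ^ 2 := by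
    rw [zpow_natCast, ← pow_mul, mul_comm, pow_mul]; norm_num
  rcases le_or_gt ρ 1 with h | h
  · exact (Real.rpow_le_one hρ0 h (by norm_num)).trans (one_le_pow₀ (by norm_num))
  · calc ρ ^ ((3 : ℝ) / 2) ≤ ρ ^ (2 : ℝ) := Real.rpow_le_rpow_of_exponent_le h.le (by norm_num)
      _ = ρ ^ 2 := Real.rpow_two ρ
      _ ≤ ((2 : ℝ) ^ (N : ℤ)) ^ 2 := pow_le_pow_left₀ hρ0 hρ₂ 2
      _ = (4 : ℝ) ^ N := h4.symm

/-- **Dilations with factor in a compact range are bounded on `Ḃ⁰_{∞,1}(ℝ³; ℂ³) ∩ L²`**: for every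
`N` there is `C` with `‖Dil_ρ h‖_{Ḃ⁰_{∞,1}} ≤ C ‖h‖_{Ḃ⁰_{∞,1}}` for all `2^{-N} ≤ ρ ≤ 2^N` and
`h ∈ L²`. -/
theorem exists_eHomBesovNorm_coe_dil_le (N : ℕ) :
    ∃ C : ℝ≥0, ∀ (ρ : ℝ), (2 : ℝ) ^ (-(N : ℤ)) ≤ ρ → ρ ≤ (2 : ℝ) ^ (N : ℤ) → ∀ h : L2C,
      eHomBesovNorm 0 ∞ 1 ((dil ρ h : L2C) : 𝓢'(EuclideanSpace ℝ (Fin 3), EuclideanSpace ℂ (Fin 3))) ≤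
        C * eHomBesovNorm 0 ∞ 1 ((h : L2C) : 𝓢'(EuclideanSpace ℝ (Fin 3), EuclideanSpace ℂ (Fin 3))) := by
  obtain ⟨C, hC⟩ := exists_tsum_eLpNormDistrib_annularMultiplier_le (E := EuclideanSpace ℝ (Fin 3))
    (F := EuclideanSpace ℂ (Fin 3)) N
  refine ⟨(4 : ℝ≥0) ^ N * C, fun ρ hρ₁ hρ₂ h => ?_⟩
  have hρ0 : 0 < ρ := lt_of_lt_of_le (zpow_pos two_pos _) hρ₁
  set u : 𝓢'(EuclideanSpace ℝ (Fin 3), EuclideanSpace ℂ (Fin 3)) :=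
    ((h : L2C) : 𝓢'(EuclideanSpace ℝ (Fin 3), EuclideanSpace ℂ (Fin 3))) with hu
  have h1 := hC ρ hρ₁ hρ₂ (LinearIsometryEquiv.refl ℝ (EuclideanSpace ℝ (Fin 3))) u
  set c : ℂ := (((ρ ^ ((3 : ℝ) / 2) : ℝ)) : ℂ) with hc
  have hc0 : c ≠ 0 := by
    rw [hc]; exact_mod_cast (Real.rpow_pos_of_pos hρ0 _).ne'
  have hcn : ‖c‖ₑ ≤ ((4 : ℝ≥0) ^ N : ℝ≥0) := by
    rw [hc, ← ofReal_norm, Complex.norm_real, Real.norm_of_nonneg (Real.rpow_nonneg hρ0.le _),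
      ENNReal.ofReal_le_iff_le_toReal ENNReal.coe_ne_top]
    simpa using rpow_three_halves_le hρ0.le hρ₂
  -- blockwise identity
  have hblock : ∀ k : ℤ, eLpNormDistrib ∞ (lpBlock k ((dil ρ h : L2C) :
      𝓢'(EuclideanSpace ℝ (Fin 3), EuclideanSpace ℂ (Fin 3)))) =
      ‖c‖ₑ * eLpNormDistrib ∞ (fourierMultiplierCLM (EuclideanSpace ℂ (Fin 3))
        (fun ξ : EuclideanSpace ℝ (Fin 3) => dyadicSymbol 0 ((((2 : ℝ) ^ (-k)) * ρ) •
          (LinearIsometryEquiv.refl ℝ (EuclideanSpace ℝ (Fin 3))) ξ)) u) := by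
    intro k
    have hsym : (fun ξ : EuclideanSpace ℝ (Fin 3) => dyadicSymbol k (((Units.mk0 ρ hρ0.ne' : ℝˣ) : ℝ) • ξ)) =
        fun ξ : EuclideanSpace ℝ (Fin 3) => dyadicSymbol 0 ((((2 : ℝ) ^ (-k)) * ρ) •
          (LinearIsometryEquiv.refl ℝ (EuclideanSpace ℝ (Fin 3))) ξ) := by
      funext ξ
      simp only [Units.val_mk0, LinearIsometryEquiv.coe_refl, id_eq]
      rw [dyadicSymbol_eq_dyadicSymbol_zero_smul k, smul_smul]
    rw [coe_dil hρ0.ne', map_smul, eLpNormDistrib_const_smul hc0, lpBlock_apply,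
      fourierMultiplierCLM_distribDilate (hasTemperateGrowth_dyadicSymbol k), eLpNormDistrib_distribDilate,
      hsym]
    have hexp : ENNReal.ofReal |(((Units.mk0 ρ hρ0.ne' : ℝˣ) : ℝ) ^
        Module.finrank ℝ (EuclideanSpace ℝ (Fin 3)))⁻¹| ^ (1 / (⊤ : ℝ≥0∞)).toReal = 1 := by
      simp
    rw [hexp, one_mul]
  rw [eHomBesovNorm_zero_one_eq_tsum]
  simp_rw [hblock]
  rw [ENNReal.tsum_mul_left]
  calc ‖c‖ₑ * ∑' k : ℤ, eLpNormDistrib ∞ (fourierMultiplierCLM (EuclideanSpace ℂ (Fin 3))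
        (fun ξ : EuclideanSpace ℝ (Fin 3) => dyadicSymbol 0 ((((2 : ℝ) ^ (-k)) * ρ) •
          (LinearIsometryEquiv.refl ℝ (EuclideanSpace ℝ (Fin 3))) ξ)) u)
      ≤ ((4 : ℝ≥0) ^ N : ℝ≥0) * (C * eHomBesovNorm 0 ∞ 1 u) := mul_le_mul' hcn h1
    _ = (((4 : ℝ≥0) ^ N * C : ℝ≥0) : ℝ≥0∞) * eHomBesovNorm 0 ∞ 1 u := by
        rw [ENNReal.coe_mul, mul_assoc]

/-! ### The slots -/

/-- **Tao's slots are bounded from `Ḃ⁰_{∞,1}` to `L^∞`**: for every averaging datum `𝒜` there are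
`n` and `C` such that for all `i`, `θ` and `f ∈ L²(ℝ³; ℂ³)`,
`‖Aᵢ(θ) f‖_{L^∞} ≤ C (∑_{j≤n} ‖m_{i,θ}‖_j) ‖f‖_{Ḃ⁰_{∞,1}}` (`Ḃ⁰_{∞,1} ∩ L² ⊂ L^∞`, and `m(D)`,
`Rot_R`, `Dil_λ` with `λ ∈ [C⁻¹, C]` are bounded on `Ḃ⁰_{∞,1}`). -/
theorem exists_eLpNorm_slot_le (𝒜 : AveragingDatum) :
    ∃ (n : ℕ) (C : ℝ≥0), ∀ (i : Fin 3) (θ : 𝒜.Ω) (f : L2C),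
      eLpNorm ((𝒜.slot i θ f : L2C) : EuclideanSpace ℝ (Fin 3) → EuclideanSpace ℂ (Fin 3)) ∞ volume ≤
        C * ENNReal.ofReal (∑ j ∈ Finset.range (n + 1), (symbolSeminorm j (𝒜.m i θ)).toReal) *
          eHomBesovNorm 0 ∞ 1 ((f : L2C) : 𝓢'(EuclideanSpace ℝ (Fin 3), EuclideanSpace ℂ (Fin 3))) := by
  obtain ⟨CL, hCL⟩ := 𝒜.lam_bdd
  obtain ⟨N, hN⟩ := pow_unbounded_of_one_lt CL one_lt_two
  obtain ⟨n, Cm, hCm⟩ := exists_eHomBesovNorm_coe_fourierMultiplier_le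
  obtain ⟨Cr, hCr⟩ := exists_eHomBesovNorm_coe_rot_le
  obtain ⟨Cd, hCd⟩ := exists_eHomBesovNorm_coe_dil_le N
  refine ⟨n, Cm * Cr * Cd, fun i θ f => ?_⟩
  have hlam0 : 0 < 𝒜.lam i θ := 𝒜.lam_pos i θ
  have hρ₂ : 𝒜.lam i θ ≤ (2 : ℝ) ^ (N : ℤ) := by
    rw [zpow_natCast]
    exact ((hCL i θ).2.trans hN.le)
  have hρ₁ : (2 : ℝ) ^ (-(N : ℤ)) ≤ 𝒜.lam i θ := by
    have hCL0 : 0 < CL := hlam0.trans_le (hCL i θ).2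
    rw [zpow_neg, zpow_natCast]
    calc ((2 : ℝ) ^ N)⁻¹ ≤ CL⁻¹ := by
          rw [inv_le_inv₀ (by positivity) hCL0]; exact hN.le
      _ ≤ 𝒜.lam i θ := (hCL i θ).1
  calc eLpNorm ((𝒜.slot i θ f : L2C) : EuclideanSpace ℝ (Fin 3) → EuclideanSpace ℂ (Fin 3)) ∞ volume
      ≤ eHomBesovNorm 0 ∞ 1 ((𝒜.slot i θ f : L2C) :
          𝓢'(EuclideanSpace ℝ (Fin 3), EuclideanSpace ℂ (Fin 3))) := F.eLpNorm_le_eHomBesovNorm_L2C _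
    _ ≤ Cm * ENNReal.ofReal (∑ j ∈ Finset.range (n + 1), (symbolSeminorm j (𝒜.m i θ)).toReal) *
          eHomBesovNorm 0 ∞ 1 ((rot (𝒜.R i θ) (dil (𝒜.lam i θ) f) : L2C) :
            𝓢'(EuclideanSpace ℝ (Fin 3), EuclideanSpace ℂ (Fin 3))) :=
        hCm (𝒜.m i θ) (𝒜.isRealSymbol i θ) _
    _ ≤ Cm * ENNReal.ofReal (∑ j ∈ Finset.range (n + 1), (symbolSeminorm j (𝒜.m i θ)).toReal) *
          (Cr * (Cd * eHomBesovNorm 0 ∞ 1 ((f : L2C) :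
            𝓢'(EuclideanSpace ℝ (Fin 3), EuclideanSpace ℂ (Fin 3))))) := by
        gcongr
        exact (hCr _ _).trans (mul_le_mul' le_rfl (hCd _ hρ₁ hρ₂ f))
    _ = ((Cm * Cr * Cd : ℝ≥0) : ℝ≥0∞) *
          ENNReal.ofReal (∑ j ∈ Finset.range (n + 1), (symbolSeminorm j (𝒜.m i θ)).toReal) *
          eHomBesovNorm 0 ∞ 1 ((f : L2C) : 𝓢'(EuclideanSpace ℝ (Fin 3), EuclideanSpace ℂ (Fin 3))) := by
        rw [ENNReal.coe_mul, ENNReal.coe_mul]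
        ring

end Summit.NavierStokesRegularity.NavierStokesRegularity.Theorems.PerpetualPumpThesis.FA

namespace Summit.NavierStokesRegularity.NavierStokesRegularity.Theorems.PerpetualPumpThesis

open Literature.Analysis.FluidPDE Literature.Analysis.FluidPDE.Tao2016
open Literature.Analysis.FunctionSpaces

/-- **Part Slot of stub `besovDuhamelBound` (registered sub-goal `stub_FA_Slot`)**: Tao's random
slots `Aᵢ(θ) = m_{i,θ}(D) Rot_{R_{i,θ}} Dil_{λ_{i,θ}}` of an averaging datum are bounded from
`Ḃ⁰_{∞,1} ∩ L²` to `L^∞`, `‖Aᵢ(θ) f‖_{L^∞} ≤ C (∑_{j ≤ n} ‖m_{i,θ}‖_j) ‖f‖_{Ḃ⁰_{∞,1}}`, with `C`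
depending only on the datum. -/
theorem stub_FA_Slot : ∀ 𝒜 : AveragingDatum, ∃ (n : ℕ) (C : NNReal), ∀ (i : Fin 3) (θ : 𝒜.Ω) (f : L2C), eLpNorm ((𝒜.slot i θ f : L2C) : EuclideanSpace ℝ (Fin 3) → EuclideanSpace ℂ (Fin 3)) ⊤ volume ≤ (C : ENNReal) * ENNReal.ofReal (∑ j ∈ Finset.range (n + 1), (symbolSeminorm j (𝒜.m i θ)).toReal) * eHomBesovNorm 0 ⊤ 1 ((f : L2C) : 𝓢'(EuclideanSpace ℝ (Fin 3), EuclideanSpace ℂ (Fin 3))) :=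
  fun 𝒜 => FA.exists_eLpNorm_slot_le 𝒜

end Summit.NavierStokesRegularity.NavierStokesRegularity.Theorems.PerpetualPumpThesis
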